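import Summits.ValiantsHypothesis.ValiantsHypothesis.Theorems.MatrixDescartes.Negative.MatrixDescartesFalseOfTropicalMonster

/-!
# Route «KPlusLogSqLaw», crux `TropicalB` (stmt-ValiantsHypothesis-19771) — CONVEX POSITION OF THE DOMINANT SET, part 1:
# incidence multisets of terms (definitions)

HONEST FRAMING.  Definitions file (D-0009: reviewed/audited) for the support theorems of
`…Theorems.KPlusLogSqLawTropicalBConvexPosition` (Sidon law, parallelogram exclusion, arc law) toward the registered stubs
`stub_tropThin` / `stub_tropFat` of the crux `Summit.ValiantsHypothesis.ValiantsHypothesis.Theses.KPlusLogSqLaw.TropicalB` (ledger item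
`stmt-ValiantsHypothesis-19771`, route `KPlusLogSqLaw`; cell `pub-symmetroid`, seat val-sym-trop-p2 g3, 2026-08-26).  It names ONE piece of
bookkeeping — no candidate law, no `Prop` is asserted — and proves its identities.  Nothing here bears on `TropicalB` inside its window,
`WeakLifting`, `KPlusLogSqLaw`, `MatrixDescartes` (stmt-ValiantsHypothesis-18050) or `VP ≠ VNP`.

THE NOTION.  A Leibniz term `p = (σ, λ)` of a dominance design of format `(m, K)` uses, in column `b`, the INCIDENCE
`(σ b, b, λ b) ∈ Fin m × Fin m × Fin K` (row, column, class).  `inc p` is the multiset of its `m` incidences — the term read as a `0/1`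
vector on entries × classes — and `ev F p = Σ_b F (σ b, b, λ b)` the value on `p` of an entry-class weight table `F`; both the slope
`Σ_b d (λ b)` and the valuation `Σ_b v (σ b, b, λ b)` of the tree's `tropWeight` are such evaluations (`tropWeight_eq_ev`), i.e. LINEAR
in the incidence vector.  Consequently every relation `Σ_k μ_k · inc (p k) = Σ_k ν_k · inc (p k)` between natural combinations of
incidence multisets transfers to every evaluation (`ev_rel`) and, when `m > 0`, forces equal total weights (`weight_eq_of_rel`); a term
is determined by its incidences (`inc_injective`); and four terms forming a column-wise parallelogram satisfy
`inc a + inc e = inc b + inc c` (`inc_add_eq_of_colwise`).  Part 2 shows that such relations among DOMINANT terms are rare (the dominant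
set is in strictly convex position in the (slope, valuation) plane).

[folklore] (incidence vectors of assignments; bookkeeping).
-/

-- `Summit.ValiantsHypothesis.ValiantsHypothesis.…` repeats a component by the D-0017 layout
-- (single-conjunct summit), which the `dupNamespace` linter flags; the name is mandated.
set_option linter.dupNamespace false
set_option autoImplicit false

namespace Summit.ValiantsHypothesis.ValiantsHypothesis.Theorems.KPlusLogSqLaw

open Summit.ValiantsHypothesis.ValiantsHypothesis.Theorems.MatrixDescartes.Negative
open scoped BigOperators
open Finset

namespace ConvexPosition

variable {m K : ℕ}

/-- the multiset of incidences `(σ b, b, λ b)` (row, column, class) of the term `(σ, λ)`, one per column `b`. [folklore] -/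
def inc (p : Equiv.Perm (Fin m) × (Fin m → Fin K)) : Multiset (Fin m × Fin m × Fin K) :=
  (univ : Finset (Fin m)).val.map fun b => (p.1 b, b, p.2 b)

/-- evaluation of an entry-class weight table `F` on a term: the sum of `F` over its incidences. [folklore] -/
def ev (F : Fin m × Fin m × Fin K → ℤ) (p : Equiv.Perm (Fin m) × (Fin m → Fin K)) : ℤ :=
  ((inc p).map F).sum

/-- the additive map «evaluate the weight table `F`» on incidence multisets. [folklore] -/
def evHom (F : Fin m × Fin m × Fin K → ℤ) : Multiset (Fin m × Fin m × Fin K) →+ ℤ :=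
  Multiset.sumAddMonoidHom.comp (Multiset.mapAddMonoidHom F)

/-- `ev F p = Σ_b F (σ b, b, λ b)`. [folklore] -/
theorem ev_eq_sum (F : Fin m × Fin m × Fin K → ℤ) (p : Equiv.Perm (Fin m) × (Fin m → Fin K)) :
    ev F p = ∑ b, F (p.1 b, b, p.2 b) := by
  unfold ev inc
  rw [Multiset.map_map]
  rfl

/-- **the tropical weight is linear in the incidence vector**: `wt_θ(p) = ev (θ·d − v) p`. [folklore] -/
theorem tropWeight_eq_ev (d : Fin K → ℕ) (v : Fin m → Fin m → Fin K → ℤ) (θ : ℤ)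
    (p : Equiv.Perm (Fin m) × (Fin m → Fin K)) :
    tropWeight d v θ p = ev (fun x => θ * (d x.2.2 : ℤ) - v x.1 x.2.1 x.2.2) p := by
  rw [ev_eq_sum]
  unfold tropWeight
  rw [Finset.mul_sum, ← Finset.sum_sub_distrib]

/-- the incidence multiset has one element per column. [folklore] -/
theorem card_inc (p : Equiv.Perm (Fin m) × (Fin m → Fin K)) : Multiset.card (inc p) = m := by
  rw [inc, Multiset.card_map, Finset.card_val, Finset.card_univ, Fintype.card_fin]

/-- membership in the incidence multiset. [folklore] -/
theorem mem_inc_iff (p : Equiv.Perm (Fin m) × (Fin m → Fin K)) (x : Fin m × Fin m × Fin K) :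
    x ∈ inc p ↔ x = (p.1 x.2.1, x.2.1, p.2 x.2.1) := by
  unfold inc
  rw [Multiset.mem_map]
  constructor
  · rintro ⟨b, -, rfl⟩
    rfl
  · intro h
    exact ⟨x.2.1, Finset.mem_univ_val _, h.symm⟩

/-- **a term is determined by its incidence multiset.** [folklore] -/
theorem inc_injective : Function.Injective (inc (m := m) (K := K)) := by
  intro p q h
  have hcol : ∀ b : Fin m, p.1 b = q.1 b ∧ p.2 b = q.2 b := by
    intro b
    have hx : (p.1 b, b, p.2 b) ∈ inc q := by
      rw [← h, mem_inc_iff]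
    rw [mem_inc_iff] at hx
    simp only [Prod.mk.injEq] at hx
    exact ⟨hx.1, hx.2.2⟩
  exact Prod.ext (Equiv.ext fun b => (hcol b).1) (funext fun b => (hcol b).2)

/-- `evHom F (inc p) = ev F p`. [folklore] -/
theorem evHom_inc (F : Fin m × Fin m × Fin K → ℤ) (p : Equiv.Perm (Fin m) × (Fin m → Fin K)) :
    evHom F (inc p) = ev F p := rfl

/-- **a relation between natural combinations of incidence multisets transfers to every linear evaluation.** [folklore] -/
theorem ev_rel {ι : Type*} (s : Finset ι) (μ ν : ι → ℕ) (P : ι → Equiv.Perm (Fin m) × (Fin m → Fin K))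
    (h : ∑ k ∈ s, μ k • inc (P k) = ∑ k ∈ s, ν k • inc (P k)) (F : Fin m × Fin m × Fin K → ℤ) :
    ∑ k ∈ s, (μ k : ℤ) * ev F (P k) = ∑ k ∈ s, (ν k : ℤ) * ev F (P k) := by
  have := congrArg (evHom F) h
  simp only [map_sum, map_nsmul, evHom_inc, nsmul_eq_mul] at this
  exact this

/-- the special case of two against two: `inc a + inc e = inc b + inc c` gives `ev F a + ev F e = ev F b + ev F c`. [folklore] -/
theorem ev_add_eq_of_inc_add_eq {a b c e : Equiv.Perm (Fin m) × (Fin m → Fin K)} (h : inc a + inc e = inc b + inc c)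
    (F : Fin m × Fin m × Fin K → ℤ) : ev F a + ev F e = ev F b + ev F c := by
  have := congrArg (evHom F) h
  simp only [map_add, evHom_inc] at this
  exact this

/-- **the total weights of a relation agree** as soon as `m > 0` (count incidences). [folklore] -/
theorem weight_eq_of_rel {ι : Type*} (hm : 0 < m) (s : Finset ι) (μ ν : ι → ℕ)
    (P : ι → Equiv.Perm (Fin m) × (Fin m → Fin K))
    (h : ∑ k ∈ s, μ k • inc (P k) = ∑ k ∈ s, ν k • inc (P k)) : ∑ k ∈ s, μ k = ∑ k ∈ s, ν k := by
  have := congrArg (⇑(Multiset.cardHom : Multiset (Fin m × Fin m × Fin K) →+ ℕ)) h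
  simp only [map_sum, map_nsmul, Multiset.cardHom_apply, card_inc, smul_eq_mul] at this
  rw [← Finset.sum_mul, ← Finset.sum_mul] at this
  exact Nat.eq_of_mul_eq_mul_right hm this

/-- column-wise pairing of two pairs of maps gives equal sums of mapped multisets. [folklore] -/
theorem map_add_map_eq {α β : Type*} (s : Multiset α) (f g f' g' : α → β)
    (h : ∀ x ∈ s, (f x = f' x ∧ g x = g' x) ∨ (f x = g' x ∧ g x = f' x)) :
    s.map f + s.map g = s.map f' + s.map g' := by
  induction s using Multiset.induction_on with
  | empty => simp
  | cons x s ih =>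
    have hx := h x (Multiset.mem_cons_self x s)
    have hs : ∀ y ∈ s, (f y = f' y ∧ g y = g' y) ∨ (f y = g' y ∧ g y = f' y) :=
      fun y hy => h y (Multiset.mem_cons_of_mem hy)
    simp only [Multiset.map_cons, Multiset.cons_add, Multiset.add_cons]
    rw [ih hs]
    rcases hx with ⟨h1, h2⟩ | ⟨h1, h2⟩
    · rw [h1, h2]
    · rw [h1, h2, Multiset.cons_swap]

/-- **column-wise parallelograms are relations**: if in every column `e` carries the (row, class) datum of `c` where `a` carries that
of `b`, and the datum of `b` where `a` carries that of `c`, then `inc a + inc e = inc b + inc c`. [folklore] -/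
theorem inc_add_eq_of_colwise {a b c e : Equiv.Perm (Fin m) × (Fin m → Fin K)}
    (hcol : ∀ j, ((a.1 j, a.2 j) = (b.1 j, b.2 j) ∧ (e.1 j, e.2 j) = (c.1 j, c.2 j)) ∨
      ((a.1 j, a.2 j) = (c.1 j, c.2 j) ∧ (e.1 j, e.2 j) = (b.1 j, b.2 j))) :
    inc a + inc e = inc b + inc c := by
  unfold inc
  apply map_add_map_eq
  intro j _
  rcases hcol j with ⟨h1, h2⟩ | ⟨h1, h2⟩
  · left
    simp only [Prod.mk.injEq] at h1 h2
    exact ⟨by rw [h1.1, h1.2], by rw [h2.1, h2.2]⟩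
  · right
    simp only [Prod.mk.injEq] at h1 h2
    exact ⟨by rw [h1.1, h1.2], by rw [h2.1, h2.2]⟩

end ConvexPosition

end Summit.ValiantsHypothesis.ValiantsHypothesis.Theorems.KPlusLogSqLaw
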